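import Literature.NumberTheory.LFunctions.AriasDeReynaTaylorLine
import Literature.NumberTheory.LFunctions.RiemannSiegelGabckeG
import Literature.NumberTheory.LFunctions.RiemannSiegelAuxiliary
import Mathlib.Analysis.SpecialFunctions.Trigonometric.DerivHyp
import HarnessLib

/-!
# Lehmer's form of the Riemann–Siegel expansion on the saddle-point line (Arias de Reyna 2011, §3)

Topic `Literature/NumberTheory/LFunctions` (namespace `Literature.NumberTheory.LFunctions.AriasDeReyna`).
Third file of the proof of the tree's named fact `Literature.NumberTheory.LFunctions.arias_lehmer_rs_bound`.
Arias de Reyna (Thm. 3.1) writes the line integral `∫_{N↙N+1} x^{−s}e^{πix²}/(e^{πix} − e^{−πix}) dx`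
(`s = σ + it`, `a = √(t/2π)`, `N = ⌊a⌋`) over the line of steepest descent through the saddle point `a` as
`(−1)^{N−1} U a^{−σ} (Σ_{k≤K} C_k(p)/a^k + RS_K)` by expanding `g̃(a, x − a)` in powers of
`τ = 1/(4√π a)`. In the tree's coordinates `x = a + u(1+i)` (`Literature.NumberTheory.LFunctions.SiegelIntegral.line`)
this is the Taylor expansion of `G_{σ,λ}(ζ) = (1−ζ)^{−σ}e^{−λf(ζ)}` (`AriasDeReynaKernel.lean`) at
`ζ = −w`, `w = (1+i)u/a` (`Literature.NumberTheory.LFunctions.Gabcke.gW`), `λ = 4πu²`: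

* `sExp σ a u` — Gabcke's exponent for general `σ` (the tree's `Gabcke.gExp` is `σ = ½`) and
  `cpow_mul_cexp_saddle_sigma` (`x^{−s}e^{πix²} = a^{−s}e^{πia²}·e^{−4πu²}·e^{E_σ}`, eq. (3.3)),
  `cexp_sExp_eq_gKer` (`e^{E_σ(a,u)} = G_{σ,4πu²}(−w)`, eqs. (3.6)/(4.4)–(4.5));
* `continuous_qCoeff` (the Taylor coefficients depend continuously on `λ`), the coefficient integrals
  `coefC σ a k` (`k ≥ 1`; `C_k(p)/a^k` is the integral of the `k`-th Taylor term, eq. (3.9)) with their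
  integrability for EVERY `a > 0` (`integrable_coefIntegrand`), and the leading coefficient `coefC0 a`
  (`C₀(p)`, eq. (5.2)) written on the pole-free line through `N + ½` (`leadM`, `leadM_eq_of_not_int`);
* **`rsLineIntegral_sub_main_eq`** — Thm. 3.1 in the form consumed by the bounds: for `a ∉ ℤ`,
  `∫_{N↙N+1} − (−1)^{N+1}U a^{−σ}Σ_{k≤K} C_k/a^k = (−1)^{N+1}U a^{−σ}·c·∫ e^{−4πu²}(−w)^{K+1}ℛ_K du/(2i sin πx)`
  with `ℛ_K` the line remainder of `AriasDeReynaTaylorLine.lean`.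

Everything is proved; no named facts.

## References

* J. Arias de Reyna, *High precision computation of Riemann's zeta function by the Riemann–Siegel
  formula, I*, Math. Comp. 80 (2011), 995–1009: §3, eqs. (3.2)–(3.11), Thm. 3.1; eq. (5.2). [AriasDeReyna2011]
* W. Gabcke, *Neue Herleitung und explizite Restabschätzung der Riemann-Siegel-Formel*, Dissertation,
  Göttingen 1979, Kap. 1 eq. (1.8). [Gabcke1979]
-/

noncomputable section

open Complex MeasureTheory Set Filter Metric intervalIntegral Real
open scoped Topology
open Literature.NumberTheory.LFunctions.SiegelIntegral Literature.NumberTheory.LFunctions.Gabcke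

namespace Literature.NumberTheory.LFunctions

namespace AriasDeReyna

variable {σ a u t : ℝ}

/-! ## The exponent `E_σ(a,u)` and the saddle-point factorisation for general `σ` -/

/-- Gabcke's exponent for general `σ`: `E_σ(a,u) = 2πia²(w − w²/2 − log(1+w)) − σ log(1+w)`,
`w = (1+i)u/a`, so that `x^{−s}e^{πix²} = a^{−s}e^{πia²}e^{−4πu²}e^{E_σ}` at `x = a + u(1+i)`,
`s = σ + 2πia²·i`. This is Arias de Reyna's `log g̃(a, x − a)`. [cite: AriasDeReyna2011, eq. (3.3) (the function `g̃`)] -/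
def sExp (σ a u : ℝ) : ℂ :=
  2 * π * I * (a : ℂ) ^ 2 * (gW a u - gW a u ^ 2 / 2 - Complex.log (1 + gW a u)) - σ * Complex.log (1 + gW a u)

/-- `a + u(1+i) = a(1 + w)`. [folklore] -/
private lemma line_eq_mul (ha : a ≠ 0) (u : ℝ) : line a u = (a : ℂ) * (1 + gW a u) := by
  have : (a : ℂ) ≠ 0 := Complex.ofReal_ne_zero.2 ha
  simp only [line, gW]; field_simp

/-- `w² = 2iu²/a²`. [folklore] -/
private lemma gW_sq (ha : a ≠ 0) : gW a u ^ 2 = 2 * I * (u : ℂ) ^ 2 / (a : ℂ) ^ 2 := by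
  have : (a : ℂ) ≠ 0 := Complex.ofReal_ne_zero.2 ha
  simp only [gW]; field_simp; ring_nf; rw [Complex.I_sq]; ring

/-- `4πu² = −2πia²w²` (the Gaussian `e^{−4πu²}` is `e^{2πia²w²}`). [cite: Gabcke1979, Kap. 1 eq. (1.8)] -/
lemma four_pi_sq_eq (ha : a ≠ 0) (u : ℝ) :
    ((4 * π * u ^ 2 : ℝ) : ℂ) = -(2 * π * I * (a : ℂ) ^ 2 * gW a u ^ 2) := by
  rw [gW_sq ha]
  have : (a : ℂ) ≠ 0 := Complex.ofReal_ne_zero.2 ha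
  field_simp
  push_cast
  ring_nf
  rw [Complex.I_sq]
  ring

/-- **Eq. (3.3) on the line of steepest descent** for general `σ`: with `t = 2πa²`, `s = σ + it`,
`x = a + u(1+i)`: `x^{−s}e^{πix²} = a^{−s}e^{πia²}·e^{−4πu²}·e^{E_σ(a,u)}`.
[cite: AriasDeReyna2011, eq. (3.3)] -/
theorem cpow_mul_cexp_saddle_sigma (ha : 0 < a) (σ u : ℝ) :
    (line a u) ^ (-((σ : ℂ) + (2 * π * a ^ 2 : ℝ) * I)) * cexp (π * I * (line a u) ^ 2) =
      (a : ℂ) ^ (-((σ : ℂ) + (2 * π * a ^ 2 : ℝ) * I)) * cexp (π * I * (a : ℂ) ^ 2)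
        * ((Real.exp (-4 * π * u ^ 2) : ℂ) * cexp (sExp σ a u)) := by
  have ha0 : a ≠ 0 := ha.ne'
  have ha' : (a : ℂ) ≠ 0 := Complex.ofReal_ne_zero.2 ha0
  have hw0 : 1 + gW a u ≠ 0 := one_add_gW_ne_zero ha0
  have hx0 : line a u ≠ 0 := by rw [line_eq_mul ha0]; exact mul_ne_zero ha' hw0
  rw [Complex.cpow_def_of_ne_zero hx0, Complex.cpow_def_of_ne_zero ha', line_eq_mul ha0,
    Complex.log_ofReal_mul ha hw0, ← Complex.ofReal_log ha.le, Complex.ofReal_exp, sExp]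
  simp only [← Complex.exp_add]
  congr 1
  set L := Complex.log (1 + gW a u)
  have hsq := gW_sq (u := u) ha0
  have key : ((Real.log a : ℂ) + L) * -((σ : ℂ) + ((2 * π * a ^ 2 : ℝ) : ℂ) * I)
      + π * I * ((a : ℂ) * (1 + gW a u)) ^ 2
      - ((Real.log a : ℂ) * -((σ : ℂ) + ((2 * π * a ^ 2 : ℝ) : ℂ) * I) + π * I * (a : ℂ) ^ 2
        + (((-4 * π * u ^ 2 : ℝ) : ℂ) + (2 * π * I * (a : ℂ) ^ 2 * (gW a u - gW a u ^ 2 / 2 - L) - σ * L)))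
      = 2 * π * I * (a : ℂ) ^ 2 * gW a u ^ 2 + 4 * π * u ^ 2 := by
    push_cast; ring
  rw [← sub_eq_zero, key, hsq]
  field_simp
  ring_nf
  rw [Complex.I_sq]
  ring

/-- `−w = −(1+i)u/a` is off the cut `[1, ∞)` (its imaginary part is `−u/a`), and `≠ 0` for `u ≠ 0`.
[cite: AriasDeReyna2011, proof of Thm. 4.2 ("`−2izτ` is on the line through `0` with direction `e^{πi/4}`")] -/
lemma neg_gW_mem_cutPlane (ha : 0 < a) (u : ℝ) : -gW a u ∈ cutPlane := by
  by_cases hu : u = 0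
  · rw [hu]; simp [gW, zero_mem_cutPlane]
  · left
    have : (-gW a u).im = -(u / a) := by simp [gW]
    rw [this, neg_ne_zero]
    exact div_ne_zero hu ha.ne'

/-- `Re(−w) = Im(−w)`: the Taylor point lies on the diagonal through `0`. [cite: AriasDeReyna2011, proof of Thm. 4.2] -/
lemma neg_gW_re_eq_im (a u : ℝ) : (-gW a u).re = (-gW a u).im := by
  simp [gW]

/-- `Re(−w) − Im(−w) = 0 < 1/2`: the Taylor point is on the side of `L` containing `0`.
[cite: AriasDeReyna2011, proof of Thm. 4.2] -/
lemma neg_gW_re_sub_im (a u : ℝ) : (-gW a u).re - (-gW a u).im < 1 / 2 := by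
  rw [neg_gW_re_eq_im]; norm_num

/-- **`e^{E_σ(a,u)} = G_{σ,4πu²}(−w)`**: Gabcke's `g̃` is Arias de Reyna's generating function after the
substitution `τ = iζ/(2z)`, at the real parameter `λ = −iz²/2 = 4πu²`.
[cite: AriasDeReyna2011, eqs. (3.6), (4.4)–(4.5)] -/
theorem cexp_sExp_eq_gKer (ha : 0 < a) (σ u : ℝ) :
    cexp (sExp σ a u) = gKer σ (4 * π * u ^ 2) (-gW a u) := by
  by_cases hu : u = 0
  · subst hu
    have : gW a 0 = 0 := by simp [gW]
    simp [sExp, this, gKer_zero]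
  have ha0 : a ≠ 0 := ha.ne'
  have hζD := neg_gW_mem_cutPlane ha u
  have hζ0 : -gW a u ≠ 0 := by
    rw [neg_ne_zero]; intro h
    have := congrArg Complex.im h
    simp [gW] at this
    rcases this with h1 | h1
    · exact hu h1
    · exact ha0 h1
  have hw0 : gW a u ≠ 0 := by rwa [neg_ne_zero] at hζ0
  rw [gKer, fKer_eq_log hζD hζ0, sExp]
  congr 1
  have e4 := four_pi_sq_eq ha0 u
  rw [sub_neg_eq_add, e4]
  field_simp
  ring

/-- Siegel's integrand on the saddle-point line for general `σ`: with `t = 2πa²`,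
`F_s(a + u(1+i)) = a^{−s}e^{πia²} · e^{−4πu²} G_{σ,4πu²}(−w)/(2i sin πx)`.
[cite: AriasDeReyna2011, eq. (3.3)] -/
theorem rsKernel_saddle_sigma (ha : 0 < a) (σ u : ℝ) :
    rsKernel ((σ : ℂ) + (2 * π * a ^ 2 : ℝ) * I) (line a u) =
      (a : ℂ) ^ (-((σ : ℂ) + (2 * π * a ^ 2 : ℝ) * I)) * cexp (π * I * (a : ℂ) ^ 2) *
        ((Real.exp (-4 * π * u ^ 2) : ℂ) * gKer σ (4 * π * u ^ 2) (-gW a u) /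
          (2 * I * Complex.sin (π * line a u))) := by
  rw [rsKernel, mul_div_assoc', cpow_mul_cexp_saddle_sigma ha σ u, cexp_sExp_eq_gKer ha, mul_div_assoc]

/-! ## Continuity of the Taylor coefficients in `λ` -/

/-- The Taylor coefficients `q_k(σ, λ)` depend continuously on `λ` (they are polynomials in `λ`; we only
need continuity, from the circle-integral formula). [cite: AriasDeReyna2011, eq. (4.4)] -/
theorem continuous_qCoeff (σ : ℝ) (k : ℕ) : Continuous fun lam : ℝ ↦ qCoeff σ lam k := by
  have hr : ∀ lam : ℝ, qCoeff σ lam k = (2 * π * I : ℂ)⁻¹ • ∫ θ in (0:ℝ)..2 * π,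
      deriv (circleMap 0 (1 / 2)) θ • ((1 / (circleMap 0 (1 / 2) θ - 0)) ^ k •
        (circleMap 0 (1 / 2) θ - 0)⁻¹ • gKer σ lam (circleMap 0 (1 / 2) θ)) := by
    intro lam
    rw [qCoeff_eq_circleIntegral σ lam k (by norm_num : (0:ℝ) < 1 / 2) (by norm_num), circleIntegral]
  simp_rw [hr, smul_eq_mul]
  refine continuous_const.mul ?_
  have hζD : ∀ θ : ℝ, circleMap 0 (1 / 2) θ ∈ cutPlane := fun θ ↦
    mem_cutPlane_of_norm_lt_one (by simp [circleMap]; norm_num)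
  have hcm : Continuous fun p : ℝ × ℝ ↦ circleMap 0 (1 / 2) p.2 := (continuous_circleMap 0 (1 / 2)).comp continuous_snd
  have hne : ∀ p : ℝ × ℝ, circleMap 0 (1 / 2) p.2 - 0 ≠ 0 := by intro p; simp [circleMap]
  have hG : Continuous fun p : ℝ × ℝ ↦ gKer σ p.1 (circleMap 0 (1 / 2) p.2) := by
    unfold gKer
    refine Continuous.cexp (Continuous.sub ?_ ?_)
    · refine continuous_const.mul ?_
      have hlog : ContinuousOn Complex.log slitPlane := fun z hz ↦ (continuousAt_clog hz).continuousWithinAt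
      exact hlog.comp_continuous (f := fun p : ℝ × ℝ ↦ 1 - circleMap 0 (1 / 2) p.2) (by fun_prop)
        fun p ↦ one_sub_mem_slitPlane (hζD p.2)
    · refine (continuous_ofReal.comp continuous_fst).mul ?_
      exact continuousOn_fKer.comp_continuous hcm fun p ↦ hζD p.2
  have hint : Continuous fun p : ℝ × ℝ ↦ deriv (circleMap 0 (1 / 2)) p.2 *
      ((1 / (circleMap 0 (1 / 2) p.2 - 0)) ^ k * ((circleMap 0 (1 / 2) p.2 - 0)⁻¹ * gKer σ p.1 (circleMap 0 (1 / 2) p.2))) := by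
    have hder : (fun p : ℝ × ℝ ↦ deriv (circleMap 0 (1 / 2)) p.2) = fun p ↦ circleMap 0 (1 / 2) p.2 * I := by
      funext p; rw [deriv_circleMap]
    refine Continuous.mul (by rw [hder]; exact hcm.mul continuous_const) ?_
    exact ((continuous_const.div (hcm.sub continuous_const) hne).pow _).mul
      (((hcm.sub continuous_const).inv₀ hne).mul hG)
  exact intervalIntegral.continuous_parametric_intervalIntegral_of_continuous' hint 0 (2 * π)

/-! ## The coefficient integrals -/

/-- The integrand of the `k`-th coefficient: `e^{−4πu²} q_k(σ, 4πu²) (−u(1+i))^k/(2i sin π(a + u(1+i)))`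
(so that `∫ = ` the integral of the `k`-th Taylor term times `a^k`). [cite: AriasDeReyna2011, eq. (3.9)] -/
def coefIntegrand (σ a : ℝ) (k : ℕ) (u : ℝ) : ℂ :=
  (Real.exp (-4 * π * u ^ 2) : ℂ) * qCoeff σ (4 * π * u ^ 2) k * (-(u : ℂ) * (1 + I)) ^ k /
    (2 * I * Complex.sin (π * line a u))

/-- The constant `c = e^{−iπ/8}·(−(1+i))` coming from `a^{−s}e^{πia²} = a^{−σ}U e^{−iπ/8}` and
`dx = (1+i)du` with the orientation `↙`. [cite: AriasDeReyna2011, eq. (3.3)] -/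
def cConst : ℂ := cexp (-(π * I / 8)) * (-(1 + I))

/-- **The coefficients `C_k` (`k ≥ 1`) of Lehmer's form on the line through the saddle point**, including
the sign `(−1)^{N+1}` of `sin πx = (−1)^N cosh(πv/2)`:
`C_k = (−1)^{N+1} c ∫ e^{−4πu²} q_k(σ,4πu²)(−u(1+i))^k du/(2i sin πx)`. [cite: AriasDeReyna2011, eqs. (3.8)–(3.9)] -/
def coefC (σ a : ℝ) (k : ℕ) : ℂ := (-1) ^ (⌊a⌋₊ + 1) * cConst * ∫ u : ℝ, coefIntegrand σ a k u

/-- `|sin π(a + u(1+i))| ≥ sinh(π|u|) ≥ π|u|` for every real `a`. [folklore] -/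
private lemma pi_mul_abs_le_norm_sin (a u : ℝ) : π * |u| ≤ ‖Complex.sin (π * line a u)‖ := by
  have hsq : ‖Complex.sin (π * line a u)‖ ^ 2 = Real.sin (π * (a + u)) ^ 2 + Real.sinh (π * u) ^ 2 := by
    rw [show (π : ℂ) * line a u = ((π * (a + u) : ℝ) : ℂ) + ((π * u : ℝ) : ℂ) * I by
      rw [line_eq]; push_cast; ring]
    exact sq_norm_sin_ofReal_add_mul_I _ _
  have hx : 0 ≤ π * |u| := by positivity
  have h3 : π * |u| ≤ Real.sinh (π * |u|) := Real.self_le_sinh_iff.2 hx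
  have h4 : Real.sinh (π * |u|) ^ 2 = Real.sinh (π * u) ^ 2 := by
    rcases abs_choice u with h | h
    · rw [h]
    · rw [h, mul_neg, Real.sinh_neg, neg_sq]
  have h5 : (π * |u|) ^ 2 ≤ ‖Complex.sin (π * line a u)‖ ^ 2 := by
    calc (π * |u|) ^ 2 ≤ Real.sinh (π * |u|) ^ 2 := pow_le_pow_left₀ hx h3 2
      _ = Real.sinh (π * u) ^ 2 := h4
      _ ≤ ‖Complex.sin (π * line a u)‖ ^ 2 := by rw [hsq]; nlinarith [sq_nonneg (Real.sin (π * (a + u)))]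
  exact (pow_le_pow_iff_left₀ hx (norm_nonneg _) two_ne_zero).1 h5

/-- Pointwise bound of the coefficient integrand, valid for EVERY real `a` (also at the integers, where
`sin πx` vanishes at `u = 0` but `u^k`, `k ≥ 1`, compensates): for `0 < r < 1`,
`|integrand| ≤ (A_σ(r) (√2)^k/(2π r^k)) |u|^{k−1} e^{−4π(1 + V(−r))u²}`. [cite: AriasDeReyna2011, proof of Thm. 4.1, eq. (4.6)] -/
theorem norm_coefIntegrand_le (σ a : ℝ) {k : ℕ} (hk : 1 ≤ k) {r : ℝ} (hr0 : 0 < r) (hr1 : r < 1) (u : ℝ) :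
    ‖coefIntegrand σ a k u‖ ≤ circleConst σ r * Real.sqrt 2 ^ k / (2 * π * r ^ k) *
      (|u| ^ (k - 1) * Real.exp (-(4 * π * (1 + (fKer (-r)).re)) * u ^ 2)) := by
  by_cases hu : u = 0
  · subst hu
    have : coefIntegrand σ a k 0 = 0 := by
      simp [coefIntegrand, zero_pow (Nat.one_le_iff_ne_zero.1 hk)]
    rw [this, norm_zero]
    exact mul_nonneg (div_nonneg (mul_nonneg (circleConst_pos hr0.le hr1).le (by positivity)) (by positivity))
      (by positivity)
  have hlam : 0 ≤ 4 * π * u ^ 2 := by positivity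
  have hq := norm_qCoeff_le (σ := σ) hr0 hr1 hlam k
  have hsin := pi_mul_abs_le_norm_sin a u
  have hsin_pos : 0 < ‖Complex.sin (π * line a u)‖ := lt_of_lt_of_le (by positivity) hsin
  have hw : ‖-(u : ℂ) * (1 + I)‖ = |u| * Real.sqrt 2 := by
    rw [norm_mul, norm_neg, Complex.norm_real, Real.norm_eq_abs]
    congr 1
    rw [show (1 : ℂ) + I = ((1 : ℝ) : ℂ) + ((1 : ℝ) : ℂ) * I by simp, Complex.norm_add_mul_I]
    norm_num
  have h2I : ‖(2 : ℂ) * I‖ = 2 := by simp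
  have hnorm : ‖coefIntegrand σ a k u‖ = Real.exp (-4 * π * u ^ 2) * ‖qCoeff σ (4 * π * u ^ 2) k‖ *
      (|u| ^ k * Real.sqrt 2 ^ k) / (2 * ‖Complex.sin (π * line a u)‖) := by
    rw [coefIntegrand, norm_div, norm_mul, norm_mul, norm_mul, norm_pow, hw, h2I, mul_pow, Complex.norm_real,
      Real.norm_eq_abs, abs_of_pos (Real.exp_pos _)]
  rw [hnorm]
  -- `|u|^k / (2 |sin|) ≤ |u|^{k-1}/(2π)`
  have hk' : |u| ^ k = |u| ^ (k - 1) * |u| := by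
    rw [← pow_succ]; congr 1; omega
  have hmain : Real.exp (-4 * π * u ^ 2) * ‖qCoeff σ (4 * π * u ^ 2) k‖ * (|u| ^ k * Real.sqrt 2 ^ k) /
      (2 * ‖Complex.sin (π * line a u)‖) ≤
      Real.exp (-4 * π * u ^ 2) * (circleConst σ r * Real.exp (-(4 * π * u ^ 2) * (fKer (-r)).re) / r ^ k) *
        (|u| ^ k * Real.sqrt 2 ^ k) / (2 * (π * |u|)) := by
    have hC := circleConst_pos (σ := σ) hr0.le hr1
    refine div_le_div₀ ?_ ?_ (by positivity) (by linarith)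
    · exact mul_nonneg (mul_nonneg (Real.exp_pos _).le (div_nonneg (mul_nonneg hC.le (Real.exp_pos _).le)
        (pow_nonneg hr0.le _))) (by positivity)
    · exact mul_le_mul_of_nonneg_right (mul_le_mul_of_nonneg_left hq (Real.exp_pos _).le) (by positivity)
  refine hmain.trans (le_of_eq ?_)
  have hupos : 0 < |u| := abs_pos.2 hu
  rw [hk']
  have hexp : Real.exp (-4 * π * u ^ 2) * Real.exp (-(4 * π * u ^ 2) * (fKer (-↑r)).re) =
      Real.exp (-(4 * π * (1 + (fKer (-↑r)).re)) * u ^ 2) := by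
    rw [← Real.exp_add]; congr 1; ring
  have hrk : r ^ k ≠ 0 := pow_ne_zero _ hr0.ne'
  rw [← hexp]
  field_simp

/-- `1 + V(−1/2) ≥ 1/2` (crudely, `log(3/2) ≤ 1/2`): the Gaussian factor of the majorant at `r = 1/2`
decays at least like `e^{−2πu²}`. [cite: AriasDeReyna2011, proof of Thm. 4.1] -/
lemma half_le_one_add_re_fKer_neg_half : 1 / 2 ≤ 1 + (fKer (-(1 / 2 : ℝ))).re := by
  rw [fKer_neg_real (by norm_num : (0:ℝ) < 1 / 2), Complex.ofReal_re]
  have h := Real.log_le_sub_one_of_pos (by norm_num : (0:ℝ) < 1 + 1 / 2)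
  norm_num at h ⊢
  linarith

/-- Measurability of the coefficient integrand (a quotient of continuous functions).
[cite: AriasDeReyna2011, eq. (3.9)] -/
lemma measurable_coefIntegrand (σ a : ℝ) (k : ℕ) : Measurable (coefIntegrand σ a k) := by
  unfold coefIntegrand
  refine Measurable.div ?_ (by fun_prop)
  refine ((Complex.continuous_ofReal.comp (by fun_prop)).mul ?_).measurable.mul (by fun_prop)
  exact (continuous_qCoeff σ k).comp (by fun_prop)

/-- **Integrability of the coefficient integrand for every real `a`** (also `a ∈ ℤ`) and `k ≥ 1`.
[cite: AriasDeReyna2011, eq. (3.9) and proof of Thm. 4.1] -/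
theorem integrable_coefIntegrand (σ a : ℝ) {k : ℕ} (hk : 1 ≤ k) : Integrable (coefIntegrand σ a k) := by
  set M : ℝ := circleConst σ (1 / 2) * Real.sqrt 2 ^ k / (2 * π * (1 / 2) ^ k) with hM
  refine Integrable.mono' ((integrable_poly_mul_gaussian (k - 1) 0 0).const_mul M)
    (measurable_coefIntegrand σ a k).aestronglyMeasurable (Eventually.of_forall fun u ↦ ?_)
  refine (norm_coefIntegrand_le σ a hk (by norm_num : (0:ℝ) < 1 / 2) (by norm_num) u).trans ?_
  rw [← hM]
  have hM0 : 0 ≤ M := div_nonneg (mul_nonneg (circleConst_pos (by norm_num) (by norm_num)).le (by positivity))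
    (by positivity)
  refine mul_le_mul_of_nonneg_left ?_ hM0
  have hm := half_le_one_add_re_fKer_neg_half
  refine mul_le_mul (pow_le_pow_left₀ (abs_nonneg u) (by linarith [abs_nonneg u]) _) ?_ (Real.exp_pos _).le
    (by positivity)
  rw [Real.exp_le_exp]
  have h0 : 0 ≤ π * u ^ 2 * (2 * (1 + (fKer (-(1 / 2 : ℝ))).re) - 1) :=
    mul_nonneg (mul_nonneg Real.pi_pos.le (sq_nonneg u)) (by linarith)
  nlinarith [h0]

/-! ## The leading coefficient on the pole-free line through `N + ½` -/

/-- `M(a) = (1+i) ∫ e^{2πi(x−a)²} dx/(2i sin πx)` over the line `x = N + ½ + u(1+i)`, `N = ⌊a⌋` — the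
Mordell integral giving `C₀(p)` (eq. (5.2)), written on a line that never meets the integers, so
that it is defined for every `a > 0` (for `a ∉ ℤ` it equals the same integral over the line through
`a`, `leadM_eq_of_not_int`). [cite: AriasDeReyna2011, eq. (5.2)] -/
def leadM (a : ℝ) : ℂ :=
  (1 + I) * ∫ u : ℝ, cexp (2 * π * I * (line (⌊a⌋₊ + 1 / 2) u - a) ^ 2) / (2 * I * Complex.sin (π * line (⌊a⌋₊ + 1 / 2) u))

/-- **The leading coefficient `C₀`** (with the sign `(−1)^{N+1}`): `C₀ = (−1)^{N+1} e^{−iπ/8} (−M(a))`.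
[cite: AriasDeReyna2011, eqs. (3.9), (5.2)] -/
def coefC0 (a : ℝ) : ℂ := (-1) ^ (⌊a⌋₊ + 1) * cexp (-(π * I / 8)) * (-leadM a)

/-- The full coefficient sequence of Lehmer's form: `C₀` and `C_k`, `k ≥ 1`. [cite: AriasDeReyna2011, eq. (3.11)] -/
def coef (σ a : ℝ) (k : ℕ) : ℂ := if k = 0 then coefC0 a else coefC σ a k

/-- `e^{2πi(u(1+i))²} = e^{−4πu²}`. [folklore] -/
private lemma cexp_sq_line_sub (a u : ℝ) :
    cexp (2 * π * I * (line a u - a) ^ 2) = (Real.exp (-4 * π * u ^ 2) : ℂ) := by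
  have h1 : line a u - a = u * (1 + I) := by simp [line]
  have h2 : ((1:ℂ) + I) ^ 2 = 2 * I := by rw [add_sq, Complex.I_sq]; ring
  rw [h1, mul_pow, h2, Complex.ofReal_exp]
  congr 1
  push_cast
  linear_combination (4 * π * (u : ℂ) ^ 2) * Complex.I_mul_I

/-- The numerator `e^{2πi(x−a)²}/(2i)` in the template of `SiegelMordellIntegral.lean`. [folklore] -/
private lemma lead_num_eq (a : ℝ) (x : ℂ) :
    cexp (2 * π * I * (x - a) ^ 2) / (2 * I)
      = ((2 * I)⁻¹ * cexp (2 * π * I * (a : ℂ) ^ 2) * cexp (π * I * x ^ 2))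
          * cexp (π * I * x ^ 2 + (-(4 * π * I * a)) * x) := by
  conv_rhs => rw [mul_assoc, mul_assoc, ← Complex.exp_add, ← Complex.exp_add]
  rw [div_eq_inv_mul]
  congr 2; ring

/-- `‖(2i)⁻¹ e^{2πia²} e^{πix²}‖ ≤ ½ e^{πc²/2}` at `x = c + u(1+i)`. [folklore] -/
private lemma norm_lead_weight_le (a c u : ℝ) :
    ‖(2 * I)⁻¹ * cexp (2 * π * I * (a : ℂ) ^ 2) * cexp (π * I * (line c u) ^ 2)‖ ≤ 1 / 2 * Real.exp (π * c ^ 2 / 2) := by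
  have h := norm_cexp_quadPhase 0 c u
  simp only [zero_mul, add_zero, zero_re, zero_im, sub_zero] at h
  have h2 : ‖cexp (2 * π * I * (a : ℂ) ^ 2)‖ = 1 := by
    rw [show 2 * ↑π * I * (a : ℂ) ^ 2 = ((2 * π * a ^ 2 : ℝ) : ℂ) * I by push_cast; ring,
      Complex.norm_exp_ofReal_mul_I]
  rw [norm_mul, norm_mul, h2, h, mul_one]
  have h1 : ‖(2 * I : ℂ)⁻¹‖ = 1 / 2 := by norm_num [norm_inv, norm_mul, Complex.norm_I]
  rw [h1]
  refine mul_le_mul_of_nonneg_left (Real.exp_le_exp.2 ?_) (by norm_num)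
  nlinarith [sq_nonneg (u + c / 2), Real.pi_pos]

/-- Integrability of `e^{2πi(x−a)²}/(2i sin πx)` along the line through any non-integer `c`. [folklore] -/
private lemma integrable_lead_line (a : ℝ) {c : ℝ} (hc : ∀ n : ℤ, (n : ℝ) ≠ c) :
    Integrable fun u : ℝ ↦ cexp (2 * π * I * (line c u - a) ^ 2) / (2 * I * Complex.sin (π * line c u)) := by
  obtain ⟨d, hd0, hd⟩ := exists_pos_le_abs_sub_int hc
  have h := integrable_mul_cexp_quadPhase_div_sin
    (g := fun u : ℝ ↦ (2 * I)⁻¹ * cexp (2 * π * I * (a : ℂ) ^ 2) * cexp (π * I * (line c u) ^ 2)) (by fun_prop)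
    (C := 1 / 2 * Real.exp (π * c ^ 2 / 2)) (N := 0)
    (fun u ↦ by simpa using norm_lead_weight_le a c u) (-(4 * π * I * a)) hd0 hd
  refine h.congr (Eventually.of_forall fun u ↦ ?_)
  simp only
  rw [← lead_num_eq, div_div]

/-- `N + ½` is not an integer. [folklore] -/
private lemma int_ne_floor_add_half (a : ℝ) : ∀ n : ℤ, (n : ℝ) ≠ ⌊a⌋₊ + 1 / 2 := by
  intro n h
  have h1 : (2 * n : ℤ) = 2 * (⌊a⌋₊ : ℤ) + 1 := by
    have : (2 * n : ℝ) = 2 * ⌊a⌋₊ + 1 := by rw [h]; ring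
    exact_mod_cast this
  omega

/-- The line may be moved from `a ∉ ℤ` to `N + ½` (no pole in between): `M(a)` is the Mordell integral
over the saddle-point line. [cite: AriasDeReyna2011, §5 ("an easy application of Cauchy's Theorem")] -/
theorem leadM_eq_of_not_int (ha : 0 < a) (hai : ∀ n : ℤ, (n : ℝ) ≠ a) :
    leadM a = (1 + I) * ∫ u : ℝ, cexp (2 * π * I * (line a u - a) ^ 2) / (2 * I * Complex.sin (π * line a u)) := by
  rw [leadM]
  congr 1
  set c : ℝ := ⌊a⌋₊ + 1 / 2 with hc
  have hci : ∀ n : ℤ, (n : ℝ) ≠ c := int_ne_floor_add_half a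
  have hfl : ⌊c⌋ = ⌊a⌋ := by
    rw [hc, ← Int.natCast_floor_eq_floor ha.le, Int.floor_eq_iff]
    simp only [Int.cast_natCast]
    constructor <;> linarith
  have key : ∀ {c₁ c₂ : ℝ}, c₁ < c₂ → (∀ n : ℤ, (n : ℝ) ≠ c₁) → (∀ n : ℤ, (n : ℝ) ≠ c₂) → ⌊c₁⌋ = ⌊c₂⌋ →
      ∫ u : ℝ, cexp (2 * π * I * (line c₂ u - a) ^ 2) / (2 * I * Complex.sin (π * line c₂ u))
        = ∫ u : ℝ, cexp (2 * π * I * (line c₁ u - a) ^ 2) / (2 * I * Complex.sin (π * line c₁ u)) := by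
    intro c₁ c₂ h12 h1 h2 hfloor
    set hnum : ℂ → ℂ := fun x ↦ cexp (2 * π * I * (x - a) ^ 2) / (2 * I) with hh
    have hker : ∀ x : ℂ, cexp (2 * π * I * (x - a) ^ 2) / (2 * I * Complex.sin (π * x))
        = hnum x / Complex.sin (π * x) := fun x ↦ by rw [hh, div_div]
    have hhd : Differentiable ℂ hnum := by rw [hh]; fun_prop
    have hint : ∀ c : ℝ, (∀ n : ℤ, (n : ℝ) ≠ c) →
        Integrable fun u : ℝ ↦ hnum (line c u) / Complex.sin (π * line c u) := fun c hcn ↦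
      (integrable_lead_line a hcn).congr (Eventually.of_forall fun u ↦ hker _)
    set M : ℝ := c₁ ^ 2 + c₂ ^ 2 with hM
    have hdecay := decay_mul_cexp_quadPhase_div_sin
      (G := fun z : ℂ ↦ (2 * I)⁻¹ * cexp (2 * π * I * (a : ℂ) ^ 2) * cexp (π * I * z ^ 2))
      (C := 1 / 2 * Real.exp (π * M / 2)) (N := 0) (c₁ := c₁) (c₂ := c₂) (fun c hcI T _ ↦ by
        simp only [pow_zero, mul_one]
        refine (norm_lead_weight_le a c T).trans (mul_le_mul_of_nonneg_left (Real.exp_le_exp.2 ?_) (by norm_num))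
        have hc2 : c ^ 2 ≤ M := by
          rw [hM]
          rcases le_or_gt 0 c with h0 | h0
          · nlinarith [hcI.2, sq_nonneg c₁]
          · nlinarith [hcI.1, sq_nonneg c₂]
        nlinarith [Real.pi_pos])
      (-(4 * π * I * a))
    have hmain := Literature.Analysis.Complex.integral_slant_div_sin_sub_eq_sum (h := hnum)
      h12 h1 h2 univ isOpen_univ (subset_univ _) hhd.differentiableOn (hint _ h1) (hint _ h2)
      (by simpa only [hh, lead_num_eq] using hdecay)
    rw [hfloor, Finset.Ioc_self, Finset.sum_empty, mul_zero, sub_eq_zero] at hmain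
    simp only [hker]
    exact hmain
  rcases lt_trichotomy a c with hlt | heq | hgt
  · exact key hlt hai hci (by rw [hfl])
  · rw [← heq]
  · exact (key hgt hci hai hfl).symm

/-! ## Thm. 3.1: the expansion on the saddle-point line -/

/-- The Stirling main-term phase `U = exp(−i((t/2)log(t/2π) − t/2 − π/8))`, `t = 2πa²`, as a function
of `a`: `U(a) = exp(−i(2πa² log a − πa² − π/8))`. [cite: AriasDeReyna2011, eq. (3.3)] -/
def uPhase (a : ℝ) : ℂ := cexp (-I * ((2 * π * a ^ 2 * Real.log a - π * a ^ 2 - π / 8 : ℝ) : ℂ))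

/-- `a^{−s} e^{πia²} = a^{−σ} U e^{−iπ/8}` (`s = σ + 2πia²·i`). [cite: AriasDeReyna2011, eq. (3.3)] -/
theorem cpow_neg_mul_cexp_eq (ha : 0 < a) (σ : ℝ) :
    (a : ℂ) ^ (-((σ : ℂ) + (2 * π * a ^ 2 : ℝ) * I)) * cexp (π * I * (a : ℂ) ^ 2) =
      (a : ℂ) ^ (-(σ : ℂ)) * uPhase a * cexp (-(π * I / 8)) := by
  have ha' : (a : ℂ) ≠ 0 := Complex.ofReal_ne_zero.2 ha.ne'
  rw [Complex.cpow_def_of_ne_zero ha', Complex.cpow_def_of_ne_zero ha', uPhase, ← Complex.ofReal_log ha.le]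
  simp only [← Complex.exp_add]
  congr 1
  push_cast
  ring

/-- For non-integer `a > 0` the line of the tree's `rsLineIntegral (N + ½)` may be taken through `a`.
[cite: AriasDeReyna2011, eq. (3.2) ("By Cauchy's Theorem")] -/
theorem rsLineIntegral_floor_half_eq (ha : 0 < a) (hai : ∀ n : ℤ, (n : ℝ) ≠ a) (s : ℂ) :
    rsLineIntegral (⌊a⌋₊ + 1 / 2) s = rsLineIntegral a s := by
  have hci := int_ne_floor_add_half a
  have hNa : (⌊a⌋₊ : ℝ) < a := lt_of_le_of_ne (Nat.floor_le ha.le) (fun h ↦ hai ⌊a⌋₊ (by exact_mod_cast h))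
  have haN : a < ⌊a⌋₊ + 1 := Nat.lt_floor_add_one a
  rcases le_or_gt a (⌊a⌋₊ + 1 / 2) with h | h
  · refine rsLineIntegral_eq_of_noInt ha h (fun n hn ↦ ?_) s
    have h1 : (⌊a⌋₊ : ℝ) < n := lt_of_lt_of_le hNa hn.1
    have h2 : (n : ℝ) < ⌊a⌋₊ + 1 := by linarith [hn.2]
    have h3 : (⌊a⌋₊ : ℤ) < n := by exact_mod_cast h1
    have h4 : n < (⌊a⌋₊ : ℤ) + 1 := by exact_mod_cast h2
    omega
  · refine (rsLineIntegral_eq_of_noInt (by positivity) h.le (fun n hn ↦ ?_) s).symm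
    have h1 : (⌊a⌋₊ : ℝ) < n := by linarith [hn.1]
    have h2 : (n : ℝ) < ⌊a⌋₊ + 1 := lt_of_le_of_lt hn.2 haN
    have h3 : (⌊a⌋₊ : ℤ) < n := by exact_mod_cast h1
    have h4 : n < (⌊a⌋₊ : ℤ) + 1 := by exact_mod_cast h2
    omega

/-- The kernel integrand on the saddle line: `F(u) = e^{−4πu²} G_{σ,4πu²}(−w)/(2i sin πx)`.
[cite: AriasDeReyna2011, eq. (3.3)] -/
def sKer (σ a u : ℝ) : ℂ :=
  (Real.exp (-4 * π * u ^ 2) : ℂ) * gKer σ (4 * π * u ^ 2) (-gW a u) / (2 * I * Complex.sin (π * line a u))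

/-- `F(u)` is Siegel's integrand divided by the constant `a^{−s}e^{πia²}`; integrable for `a ∉ ℤ`.
[cite: AriasDeReyna2011, eq. (3.3)] -/
lemma integrable_sKer (ha : 0 < a) (hai : ∀ n : ℤ, (n : ℝ) ≠ a) (σ : ℝ) : Integrable (sKer σ a) := by
  obtain ⟨d, hd0, hd⟩ := exists_pos_le_abs_sub_int hai
  set s : ℂ := (σ : ℂ) + (2 * π * a ^ 2 : ℝ) * I with hs
  set E : ℂ := (a : ℂ) ^ (-s) * cexp (π * I * (a : ℂ) ^ 2) with hE
  have ha' : (a : ℂ) ≠ 0 := Complex.ofReal_ne_zero.2 ha.ne'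
  have hE0 : E ≠ 0 :=
    mul_ne_zero (fun h ↦ ha' ((Complex.cpow_eq_zero_iff _ _).1 h).1) (Complex.exp_ne_zero _)
  have hker : ∀ u : ℝ, sKer σ a u = E⁻¹ * rsKernel s (line a u) := by
    intro u
    rw [hs, rsKernel_saddle_sigma ha σ u, ← hs, ← hE, ← mul_assoc, inv_mul_cancel₀ hE0, one_mul, sKer]
  rw [show sKer σ a = fun u ↦ E⁻¹ * rsKernel s (line a u) from funext hker]
  exact (integrable_rsKernel_line s ha hd0 hd).const_mul _

/-- The `k`-th Taylor term of the kernel integrand is `a^{−k}` times the coefficient integrand.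
[cite: AriasDeReyna2011, eq. (3.8)] -/
lemma taylorTerm_eq (ha : 0 < a) (σ : ℝ) (k : ℕ) (u : ℝ) :
    (Real.exp (-4 * π * u ^ 2) : ℂ) * (qCoeff σ (4 * π * u ^ 2) k * (-gW a u) ^ k) /
        (2 * I * Complex.sin (π * line a u)) = coefIntegrand σ a k u / (a : ℂ) ^ k := by
  have ha' : (a : ℂ) ≠ 0 := Complex.ofReal_ne_zero.2 ha.ne'
  have hw : -gW a u = (-(u : ℂ) * (1 + I)) / a := by simp only [gW]; ring
  rw [coefIntegrand, hw, div_pow]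
  field_simp

/-- **Arias de Reyna's Thm. 3.1 (Lehmer's form of the Riemann–Siegel expansion) on the saddle-point
line, with the remainder as an explicit integral.** For `a > 0` not an integer, `σ` real, `t = 2πa²`,
`s = σ + it`, `N = ⌊a⌋`, `K ≥ 1` with `K + σ ≥ 1`:
`∫_{N↙N+1} F_s − (−1)^{N+1} U a^{−σ} Σ_{k≤K} C_k/a^k = (−1)^{N+1} U a^{−σ} · (−1)^{N+1} c · ∫ e^{−4πu²}(−w)^{K+1}ℛ_K(u) du/(2i sin πx)`,
`ℛ_K(u) = lineRem σ (4πu²) K (−w)`, `w = (1+i)u/a`. [cite: AriasDeReyna2011, Thm. 3.1, eqs. (3.8)–(3.11)] -/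
theorem rsLineIntegral_sub_main_eq (ha : 0 < a) (hai : ∀ n : ℤ, (n : ℝ) ≠ a) (σ : ℝ) {K : ℕ}
    (hK1 : 1 ≤ K) (hKσ : 1 ≤ (K : ℝ) + σ) :
    rsLineIntegral (⌊a⌋₊ + 1 / 2) ((σ : ℂ) + (2 * π * a ^ 2 : ℝ) * I) -
        (-1) ^ (⌊a⌋₊ + 1) * uPhase a * (a : ℂ) ^ (-(σ : ℂ)) *
          ∑ k ∈ Finset.range (K + 1), coef σ a k / (a : ℂ) ^ k =
      (-1) ^ (⌊a⌋₊ + 1) * uPhase a * (a : ℂ) ^ (-(σ : ℂ)) *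
        ((-1) ^ (⌊a⌋₊ + 1) * cConst * ∫ u : ℝ, (Real.exp (-4 * π * u ^ 2) : ℂ) *
          ((-gW a u) ^ (K + 1) * lineRem σ (4 * π * u ^ 2) K (-gW a u)) / (2 * I * Complex.sin (π * line a u))) := by
  set s : ℂ := (σ : ℂ) + (2 * π * a ^ 2 : ℝ) * I with hs
  set N : ℕ := ⌊a⌋₊ with hN
  have ha' : (a : ℂ) ≠ 0 := Complex.ofReal_ne_zero.2 ha.ne'
  -- Step 1: the line integral through `a` in terms of `F = sKer`
  have hJ : rsLineIntegral (N + 1 / 2) s = -(1 + I) * ((a : ℂ) ^ (-s) * cexp (π * I * (a : ℂ) ^ 2)) *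
      ∫ u : ℝ, sKer σ a u := by
    rw [hN, rsLineIntegral_floor_half_eq ha hai, rsLineIntegral]
    have hker : ∀ u : ℝ, rsKernel s (line a u) = ((a : ℂ) ^ (-s) * cexp (π * I * (a : ℂ) ^ 2)) * sKer σ a u := by
      intro u; rw [hs, rsKernel_saddle_sigma ha σ u, sKer]
    simp_rw [hker, MeasureTheory.integral_const_mul]
    ring
  -- Step 2: Taylor expansion of the kernel, pointwise
  have htaylor : ∀ u : ℝ, sKer σ a u = ∑ k ∈ Finset.range (K + 1), coefIntegrand σ a k u / (a : ℂ) ^ k +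
      (Real.exp (-4 * π * u ^ 2) : ℂ) * ((-gW a u) ^ (K + 1) * lineRem σ (4 * π * u ^ 2) K (-gW a u)) /
        (2 * I * Complex.sin (π * line a u)) := by
    intro u
    rw [sKer, gKer_eq_taylor_add_lineRem (by positivity) hK1 hKσ (neg_gW_re_sub_im a u)]
    simp_rw [← taylorTerm_eq ha σ]
    rw [mul_add, add_div, Finset.mul_sum, Finset.sum_div]
  -- Step 3: integrate termwise
  have hint_k : ∀ k ∈ Finset.range (K + 1), Integrable fun u : ℝ ↦ coefIntegrand σ a k u / (a : ℂ) ^ k := by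
    intro k hk
    rcases Nat.eq_zero_or_pos k with h0 | hpos
    · -- `k = 0`: the leading integrand, integrable on the line through `a ∉ ℤ`
      subst h0
      have : (fun u : ℝ ↦ coefIntegrand σ a 0 u / (a : ℂ) ^ 0) =
          fun u : ℝ ↦ cexp (2 * π * I * (line a u - a) ^ 2) / (2 * I * Complex.sin (π * line a u)) := by
        funext u
        rw [pow_zero, div_one, coefIntegrand, qCoeff_zero, pow_zero, mul_one, mul_one, cexp_sq_line_sub]
      rw [this]
      exact integrable_lead_line a hai
    · exact (integrable_coefIntegrand σ a hpos).div_const _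
  have hint_sum : Integrable fun u : ℝ ↦ ∑ k ∈ Finset.range (K + 1), coefIntegrand σ a k u / (a : ℂ) ^ k :=
    integrable_finsetSum _ hint_k
  have hint_rem : Integrable fun u : ℝ ↦ (Real.exp (-4 * π * u ^ 2) : ℂ) *
      ((-gW a u) ^ (K + 1) * lineRem σ (4 * π * u ^ 2) K (-gW a u)) / (2 * I * Complex.sin (π * line a u)) := by
    have h := (integrable_sKer ha hai σ).sub hint_sum
    refine h.congr (Eventually.of_forall fun u ↦ ?_)
    simp only [Pi.sub_apply]
    rw [htaylor u]
    ring
  have hsplit : ∫ u : ℝ, sKer σ a u = ∑ k ∈ Finset.range (K + 1), (∫ u : ℝ, coefIntegrand σ a k u) / (a : ℂ) ^ k +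
      ∫ u : ℝ, (Real.exp (-4 * π * u ^ 2) : ℂ) * ((-gW a u) ^ (K + 1) * lineRem σ (4 * π * u ^ 2) K (-gW a u)) /
        (2 * I * Complex.sin (π * line a u)) := by
    simp_rw [htaylor]
    rw [integral_add hint_sum hint_rem, integral_finsetSum _ hint_k]
    congr 1
    refine Finset.sum_congr rfl fun k _ ↦ ?_
    rw [MeasureTheory.integral_div]
  -- Step 4: the `k = 0` integral is `M(a)/(1+i)`
  have h1I : (1 : ℂ) + I ≠ 0 := by norm_num [Complex.ext_iff]
  have hlead : ∫ u : ℝ, coefIntegrand σ a 0 u = leadM a / (1 + I) := by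
    rw [leadM_eq_of_not_int ha hai, mul_div_cancel_left₀ _ h1I]
    refine integral_congr_ae (Eventually.of_forall fun u ↦ ?_)
    show coefIntegrand σ a 0 u = cexp (2 * π * I * (line a u - a) ^ 2) / (2 * I * Complex.sin (π * line a u))
    rw [coefIntegrand, qCoeff_zero, pow_zero, mul_one, mul_one, cexp_sq_line_sub]
  -- Step 5: identify the coefficients
  have hcoef : ∀ k ∈ Finset.range (K + 1),
      (-1) ^ (N + 1) * cConst * ((∫ u : ℝ, coefIntegrand σ a k u) / (a : ℂ) ^ k) = coef σ a k / (a : ℂ) ^ k := by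
    intro k _
    rcases Nat.eq_zero_or_pos k with h0 | hpos
    · subst h0
      rw [coef, if_pos rfl, hlead, coefC0, cConst, pow_zero, div_one, div_one, hN]
      field_simp
    · rw [coef, if_neg hpos.ne', coefC, hN]
      ring
  -- Step 6: assemble
  have hsign : ((-1 : ℂ) ^ (N + 1)) * ((-1 : ℂ) ^ (N + 1)) = 1 := by
    rw [← pow_add, ← two_mul, pow_mul]; norm_num
  have hconst : -(1 + I) * ((a : ℂ) ^ (-s) * cexp (π * I * (a : ℂ) ^ 2)) =
      (-1) ^ (N + 1) * uPhase a * (a : ℂ) ^ (-(σ : ℂ)) * ((-1) ^ (N + 1) * cConst) := by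
    rw [hs, cpow_neg_mul_cexp_eq ha σ, cConst]
    linear_combination ((1 + I) * ((a : ℂ) ^ (-(σ : ℂ)) * uPhase a * cexp (-(π * I / 8)))) * hsign
  rw [hJ, hsplit, hconst]
  have hsum : (-1) ^ (N + 1) * uPhase a * (a : ℂ) ^ (-(σ : ℂ)) * ∑ k ∈ Finset.range (K + 1), coef σ a k / (a : ℂ) ^ k
      = (-1) ^ (N + 1) * uPhase a * (a : ℂ) ^ (-(σ : ℂ)) * ((-1) ^ (N + 1) * cConst) *
          ∑ k ∈ Finset.range (K + 1), (∫ u : ℝ, coefIntegrand σ a k u) / (a : ℂ) ^ k := by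
    rw [Finset.mul_sum, Finset.mul_sum]
    refine Finset.sum_congr rfl fun k hk ↦ ?_
    rw [← hcoef k hk]
    ring
  rw [hsum]
  ring

end AriasDeReyna

end Literature.NumberTheory.LFunctions
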